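import Mathlib.Analysis.Calculus.ContDiff.Basic
import Mathlib.Analysis.Calculus.ContDiff.FTaylorSeries
import Mathlib.Analysis.Calculus.IteratedDeriv.Lemmas
import HarnessLib

/-!
# Iterated derivatives of the restriction of a function to a line

Topic `Literature/Analysis/Calculus`; the companion of `IteratedDifferenceDerivBound.lean` (differences along a vector
are differences of the restriction to a line, bounded by the iterated derivative of that restriction).  Here the
iterated derivative of the restriction `s ↦ R(t + s • w)` of a `Cⁿ` function `R : V → F` to the line through `t` in
the direction `w` is identified with the iterated Fréchet derivative of `R` evaluated on `(w, …, w)`, whence the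
ANISOTROPIC bound `‖∂ₛⁿ R(t + s w)‖ ≤ ‖DⁿR(t + s w)‖ · ‖w‖ⁿ`: a direction `w` that is short in the natural coordinates
of `R` yields small derivatives — the mechanism behind the `h`-uniform symbol estimates of
Benfatto–Giuliani–Mastropietro 2006, Lemma 2.2, where the symbol is a FIXED smooth function of rescaled coordinates
`t = A⁻¹(k - k_F)` and a unit step in `k` is the short vector `A⁻¹w` (`‖A⁻¹n‖ = γ^{-h}`, `‖A⁻¹τ‖ = γ^{-h/2}`).

* `contDiff_lineRestriction` — the restriction to a line of a `Cⁿ` function is `Cⁿ`;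
* **`iteratedDeriv_lineRestriction`** — `iteratedDeriv n (s ↦ R(t + s • w)) s = DⁿR(t + s • w)(w, …, w)`;
* **`norm_iteratedDeriv_lineRestriction_le`** — `‖iteratedDeriv n (s ↦ R(t + s • w)) s‖ ≤ ‖DⁿR(t + s • w)‖ ‖w‖ⁿ`;
* `lineRestriction_comp_affine` — through an affine change of variables `Φ = R ∘ B ∘ (· + c)` (`B` linear) the line
  through `q` along `w` is the line through `B(q + c)` along `B w`: `Φ(q + s • w) = R(B(q + c) + s • B w)`.

Everything is proved; no definitions, no named facts. [folklore]

## Sources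

G. Benfatto, A. Giuliani, V. Mastropietro, Ann. Henri Poincaré 7 (2006) 809–898, Lemma 2.2 (proof: change of
variables to the sector box followed by integration by parts) (`BenfattoGiulianiMastropietro2006`).  Routine calculus
("folklore"); Mathlib: `ContinuousLinearMap.iteratedFDeriv_comp_right`, `iteratedFDeriv_comp_add_left`.
-/

noncomputable section

open Set

namespace Literature.Analysis.Calculus

variable {V F : Type*} [NormedAddCommGroup V] [NormedSpace ℝ V] [NormedAddCommGroup F] [NormedSpace ℝ F]

/-- **The restriction of a `Cⁿ` function to a line is `Cⁿ`.** [folklore] -/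
theorem contDiff_lineRestriction {n : WithTop ℕ∞} {R : V → F} (hR : ContDiff ℝ n R) (t w : V) :
    ContDiff ℝ n fun s : ℝ => R (t + s • w) :=
  hR.comp (contDiff_const.add (contDiff_id.smul contDiff_const))

/-- **The iterated derivative along a line is the iterated Fréchet derivative on the direction**:
`iteratedDeriv n (s ↦ R(t + s • w)) s = DⁿR(t + s • w)(w, …, w)` for `R` of class `Cⁿ`. [folklore] -/
theorem iteratedDeriv_lineRestriction {n : ℕ} {R : V → F} (hR : ContDiff ℝ n R) (t w : V) (s : ℝ) :
    iteratedDeriv n (fun s : ℝ => R (t + s • w)) s = iteratedFDeriv ℝ n R (t + s • w) fun _ => w := by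
  -- the line is the composition of the translation by `t` with the linear map `s ↦ s • w`
  set Lw : ℝ →L[ℝ] V := ContinuousLinearMap.toSpanSingleton ℝ w with hLw
  have hline : (fun s : ℝ => R (t + s • w)) = (fun y : V => R (t + y)) ∘ Lw := by
    funext s
    simp [hLw, ContinuousLinearMap.toSpanSingleton_apply]
  have hRt : ContDiff ℝ n fun y : V => R (t + y) := hR.comp (contDiff_const.add contDiff_id)
  rw [iteratedDeriv_eq_iteratedFDeriv, hline, ContinuousLinearMap.iteratedFDeriv_comp_right Lw hRt s le_rfl,
    ContinuousMultilinearMap.compContinuousLinearMap_apply, iteratedFDeriv_comp_add_left]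
  congr 1
  simp [hLw, ContinuousLinearMap.toSpanSingleton_apply]

/-- **The anisotropic bound for derivatives along a line**:
`‖iteratedDeriv n (s ↦ R(t + s • w)) s‖ ≤ ‖DⁿR(t + s • w)‖ · ‖w‖ⁿ` for `R` of class `Cⁿ`. [folklore] -/
theorem norm_iteratedDeriv_lineRestriction_le {n : ℕ} {R : V → F} (hR : ContDiff ℝ n R) (t w : V) (s : ℝ) :
    ‖iteratedDeriv n (fun s : ℝ => R (t + s • w)) s‖ ≤ ‖iteratedFDeriv ℝ n R (t + s • w)‖ * ‖w‖ ^ n := by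
  rw [iteratedDeriv_lineRestriction hR t w s]
  refine (ContinuousMultilinearMap.le_opNorm _ _).trans (le_of_eq ?_)
  rw [Finset.prod_const, Finset.card_univ, Fintype.card_fin]

/-- The same with a uniform bound on the Fréchet derivative: if `‖DⁿR‖ ≤ K` everywhere then
`‖iteratedDeriv n (s ↦ R(t + s • w)) s‖ ≤ K ‖w‖ⁿ` for all `t, s`. [folklore] -/
theorem norm_iteratedDeriv_lineRestriction_le_of_le {n : ℕ} {R : V → F} (hR : ContDiff ℝ n R) {K : ℝ}
    (hK : ∀ x, ‖iteratedFDeriv ℝ n R x‖ ≤ K) (t w : V) (s : ℝ) :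
    ‖iteratedDeriv n (fun s : ℝ => R (t + s • w)) s‖ ≤ K * ‖w‖ ^ n :=
  (norm_iteratedDeriv_lineRestriction_le hR t w s).trans
    (mul_le_mul_of_nonneg_right (hK _) (pow_nonneg (norm_nonneg _) _))

/-- **Lines through an affine change of variables**: if `Φ = R ∘ B ∘ (· + c)` with `B` linear, the restriction of
`Φ` to the line through `q` along `w` is the restriction of `R` to the line through `B(q + c)` along `B w`. [folklore] -/
theorem lineRestriction_comp_affine {W F' : Type*} [NormedAddCommGroup W] [NormedSpace ℝ W] (R : V → F')
    (B : W →L[ℝ] V) (c q w : W) :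
    (fun s : ℝ => ((R ∘ B) ∘ fun x => x + c) (q + s • w)) = fun s : ℝ => R (B (q + c) + s • B w) := by
  funext s
  simp only [Function.comp_apply, map_add, map_smul]
  congr 1
  abel

end Literature.Analysis.Calculus
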